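import Mathlib
import HarnessLib
import Summits.MatrixMultiplication.MatrixMultiplication.Theorems.OutsiderSandwichToricCeilingPowFibres
import Summits.MatrixMultiplication.MatrixMultiplication.Theorems.OutsiderSandwichToricCeilingPowMixedGlue
import Summits.MatrixMultiplication.MatrixMultiplication.Theorems.OutsiderSandwichToricCeilingPowMixedRules

/-!
# OutsiderSandwich — the letter law does NOT imply matchability: lawful UNMATCHABLE complements
in `cw ⊠ cw` (co-size 2) and in `D ⊠ D` (co-size 3) (decomp-mm lens 4, gen 46, kernel K46-10;
THESES-FREE, `ω`-free; TORIC · `N = 2` · NEC-side instrument toward `LaserTangency`, stmt-32268 —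
it does not touch the route's cut or the rates of `LaserTangency`)

WHY.  The matching engines of K45 (`…PowSubTwo`, tight basis) and K46 (`…PowMixed`, one cw
coordinate) prove the toric ceilings `#Ψ ≤ 3^N - 3` by showing that every complement obeying the
LETTER LAW (`twice` at a permutation coordinate, `cwLaw` at a cw coordinate; K44-1) carries a
perfect matching for every word length `m ≥ 2` (and two for `m ≥ 3`).  The two next rungs —
product bases with TWO OR MORE cw coordinates, and the tight ceiling `3^N - 4` (co-size-3
complements, law: every letter exactly three times) — cannot be run on the same induction
hypothesis, because there it is FALSE at `m = 2`.  This file records the two obstructions as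
kernel facts (explicit witnesses with an ISOLATED vertex: an `x`-word of the complement lying on no
frame triple avoiding the removed `y`- and `z`-words), together with the general lemma
`isPMκ_false_of_isolated` an engine can reuse.

DATA (NODE-g46 §5, Python, not certified here): in `cw ⊠ cw` 156 of the 1 440 lawful co-size-2
complements have no perfect matching (24 of them with an isolated vertex); in `D ⊠ D` 1 296 of the
7 392 lawful co-size-3 complements have none (324 with an isolated vertex).

MAIN THEOREMS.
* `isPMκ_false_of_isolated` — an isolated `x`-vertex kills every perfect matching (any `m`,
  any `κ`).
* `cwcw_lawful_unmatchable` — `κ ≡ true` on `Fin 2`: the complement of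
  `X = {12, 21}`, `Y = {00, 11}`, `Z = {01, 10}` obeys `cwLaw` at both coordinates and has NO
  perfect matching (the `x`-word `11` is isolated).
* `dd_lawful3_unmatchable` — `κ ≡ false` on `Fin 2`: the complement of
  `X = {00, 01, 12}`, `Y = {02, 10, 21}`, `Z = {11, 20, 22}` has every letter exactly three times at
  each coordinate and NO perfect matching (the `x`-word `02` is isolated).
-/

set_option linter.dupNamespace false

namespace Summit.MatrixMultiplication.MatrixMultiplication.Theorems.OutsiderSandwichToricCeilingPowLawNoMatching

open Finset
open Summit.MatrixMultiplication.MatrixMultiplication.Theorems.OutsiderSandwichToricCeilingPowFibres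
  (Word Tr3 slotB frame)
open Summit.MatrixMultiplication.MatrixMultiplication.Theorems.OutsiderSandwichToricCeilingPowMixedGlue
  (isPMκ isPMκ_iff mem_frame)
open Summit.MatrixMultiplication.MatrixMultiplication.Theorems.OutsiderSandwichToricCeilingPowMixedRules
  (cwLaw)

/-! ## §1 An isolated vertex kills every perfect matching -/

/-- **Isolated-vertex obstruction.**  If some `x₀ ∉ X` lies on no triple of `frame κ` whose `y`- and
`z`-legs avoid `Y` and `Z`, then the complement of `(X, Y, Z)` in `frame κ` has no perfect matching
(letter form of the hypothesis, reusable for every `m` and `κ`). [new] -/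
theorem isPMκ_false_of_isolated {m : ℕ} {κ : Fin m → Bool} {X Y Z : Finset (Word m)}
    (x₀ : Word m) (hx₀ : x₀ ∉ X)
    (hiso : ∀ u v : Word m, (∀ i, slotB (κ i) (x₀ i) (u i) (v i) = true) → u ∉ Y → v ∉ Z → False)
    (P : Finset (Tr3 m)) : isPMκ κ P X Y Z = false := by
  rw [Bool.eq_false_iff]
  intro h
  obtain ⟨hsub, -, -, -, hX, hY, hZ⟩ := isPMκ_iff.1 h
  have hx : x₀ ∈ P.image (fun t => t.1) := by
    rw [hX]; exact mem_sdiff.2 ⟨mem_univ _, hx₀⟩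
  obtain ⟨t, ht, rfl⟩ := mem_image.1 hx
  have hy : t.2.1 ∈ univ \ Y := hY ▸ mem_image_of_mem _ ht
  have hz : t.2.2 ∈ univ \ Z := hZ ▸ mem_image_of_mem _ ht
  exact hiso t.2.1 t.2.2 (mem_frame.1 (hsub ht)) (mem_sdiff.1 hy).2 (mem_sdiff.1 hz).2

/-- Every word of length `2` is the vector of its two letters. -/
theorem vec_eta (w : Word 2) : ![w 0, w 1] = w := by
  ext i; fin_cases i <;> rfl

/-! ## §2 `cw ⊠ cw`, co-size 2: the cw letter law does not imply matchability -/

/-- The letter-level core of the `cw ⊠ cw` witness: no letters `(a, b)` for the `y`-word and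
`(c, d)` for the `z`-word complete the `x`-word `11` to a frame triple avoiding `Y = {00, 11}` and
`Z = {01, 10}`. -/
theorem cwcw_isolated_core : ∀ a b c d : Fin 3,
    slotB true 1 a c = true → slotB true 1 b d = true →
    (![a, b] : Word 2) ≠ ![0, 0] → (![a, b] : Word 2) ≠ ![1, 1] →
    (![c, d] : Word 2) ≠ ![0, 1] → (![c, d] : Word 2) ≠ ![1, 0] → False := by
  decide

/-- **`cw ⊠ cw` (N = 2): a LAWFUL co-size-2 complement WITHOUT a perfect matching.**  The removed
pairs `X = {12, 21}`, `Y = {00, 11}`, `Z = {01, 10}` are pairs of distinct words obeying `cwLaw` at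
both coordinates, and no perfect matching of the complement exists (the `x`-word `11` is isolated).
Hence «every lawful complement has a PM» — the induction hypothesis of K45/K46 — fails as soon as
two cw coordinates meet.  [TORIC · N = 2 · NEC-side instrument; negative engine fact] [new] -/
theorem cwcw_lawful_unmatchable : ∃ x₁ x₂ y₁ y₂ z₁ z₂ : Word 2,
    x₁ ≠ x₂ ∧ y₁ ≠ y₂ ∧ z₁ ≠ z₂ ∧
    (∀ i, cwLaw (x₁ i) (x₂ i) (y₁ i) (y₂ i) (z₁ i) (z₂ i) = true) ∧
    ∀ P : Finset (Tr3 2), isPMκ (fun _ : Fin 2 => true) P {x₁, x₂} {y₁, y₂} {z₁, z₂} = false := by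
  refine ⟨![1, 2], ![2, 1], ![0, 0], ![1, 1], ![0, 1], ![1, 0], by decide, by decide, by decide,
    by decide, fun P => isPMκ_false_of_isolated ![1, 1] (by decide) (fun u v h hu hv => ?_) P⟩
  simp only [mem_insert, mem_singleton, not_or] at hu hv
  exact cwcw_isolated_core (u 0) (u 1) (v 0) (v 1) (h 0) (h 1) (by rw [vec_eta]; exact hu.1)
    (by rw [vec_eta]; exact hu.2) (by rw [vec_eta]; exact hv.1) (by rw [vec_eta]; exact hv.2)

/-! ## §3 `D ⊠ D`, co-size 3: the «every letter thrice» law does not imply matchability -/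

/-- The letter-level core of the `D ⊠ D` witness: no letters complete the `x`-word `02` to a
permutation-frame triple avoiding `Y = {02, 10, 21}` and `Z = {11, 20, 22}`. -/
theorem dd_isolated_core : ∀ a b c d : Fin 3,
    slotB false 0 a c = true → slotB false 2 b d = true →
    (![a, b] : Word 2) ≠ ![0, 2] → (![a, b] : Word 2) ≠ ![1, 0] → (![a, b] : Word 2) ≠ ![2, 1] →
    (![c, d] : Word 2) ≠ ![1, 1] → (![c, d] : Word 2) ≠ ![2, 0] → (![c, d] : Word 2) ≠ ![2, 2] →
    False := by
  decide

/-- **`D ⊠ D` (N = 2): a LAWFUL co-size-3 complement WITHOUT a perfect matching.**  The removed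
triples `X = {00, 01, 12}`, `Y = {02, 10, 21}`, `Z = {11, 20, 22}` consist of distinct words, every
letter occurs exactly three times among the nine removed letters at each coordinate (the co-size-3
letter law, K44-1), and no perfect matching of the complement exists (the `x`-word `02` is
isolated).  Hence a co-size-3 engine for the tight ceiling `3^N - 4` cannot start from «every lawful
complement has a PM» at `m = 2` either.  [TORIC · N = 2 · NEC-side instrument; negative engine fact]
[new] -/
theorem dd_lawful3_unmatchable : ∃ x₁ x₂ x₃ y₁ y₂ y₃ z₁ z₂ z₃ : Word 2,
    x₁ ≠ x₂ ∧ x₁ ≠ x₃ ∧ x₂ ≠ x₃ ∧ y₁ ≠ y₂ ∧ y₁ ≠ y₃ ∧ y₂ ≠ y₃ ∧ z₁ ≠ z₂ ∧ z₁ ≠ z₃ ∧ z₂ ≠ z₃ ∧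
    (∀ i, ∀ α : Fin 3,
      List.count α [x₁ i, x₂ i, x₃ i, y₁ i, y₂ i, y₃ i, z₁ i, z₂ i, z₃ i] = 3) ∧
    ∀ P : Finset (Tr3 2),
      isPMκ (fun _ : Fin 2 => false) P {x₁, x₂, x₃} {y₁, y₂, y₃} {z₁, z₂, z₃} = false := by
  refine ⟨![0, 0], ![0, 1], ![1, 2], ![0, 2], ![1, 0], ![2, 1], ![1, 1], ![2, 0], ![2, 2],
    by decide, by decide, by decide, by decide, by decide, by decide, by decide, by decide,
    by decide, by decide,
    fun P => isPMκ_false_of_isolated ![0, 2] (by decide) (fun u v h hu hv => ?_) P⟩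
  simp only [mem_insert, mem_singleton, not_or] at hu hv
  exact dd_isolated_core (u 0) (u 1) (v 0) (v 1) (h 0) (h 1) (by rw [vec_eta]; exact hu.1)
    (by rw [vec_eta]; exact hu.2.1) (by rw [vec_eta]; exact hu.2.2) (by rw [vec_eta]; exact hv.1)
    (by rw [vec_eta]; exact hv.2.1) (by rw [vec_eta]; exact hv.2.2)

end Summit.MatrixMultiplication.MatrixMultiplication.Theorems.OutsiderSandwichToricCeilingPowLawNoMatching
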